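import Mathlib

/-!
# The algebraic approach to Gauss rules: the Hankel system for the node polynomial
# (Davis–Rabinowitz, Sect. 2.7.2 (2.7.2.1)–(2.7.2.5))

If an `n`-point rule `Σ wᵢ f(xᵢ)` reproduces the moments `m_j = ∫ w(x) x^j dx` for `j = 0, …, 2n-1`
(2.7.2.1)–(2.7.2.2) and `p(x) = Π (x - xᵢ) = Σ_{k=0}^{n} c_k x^k` is the node polynomial (2.7.2.3), then
multiplying the `(k+j)`-th moment equation by `c_k` and summing over `k` (2.7.2.4) gives, since
`Σ_k c_k xᵢ^{k} = p(xᵢ) = 0`, the linear (Hankel) system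

  `m_j c_0 + m_{j+1} c_1 + ⋯ + m_{j+n} c_n = 0`,  `j = 0, 1, …, n - 1`                     (2.7.2.5)

for the coefficients of `p` — the starting point of the algebraic (Prony-type) determination of Gauss
rules. This file records (2.7.2.5) for an abstract moment sequence (any weights and nodes in a field),
and the converse bookkeeping step: the Hankel system together with the first `n` moment equations gives
back all `2n` moment equations (`moments_of_hankel_of_low_moments`).
-/

namespace Literature.Analysis.Quadrature

open Polynomial Finset

variable {K : Type*} [Field K]

/-- The node polynomial `p(x) = Π_i (x - x_i)` of (2.7.2.3). [cite: DavisRabinowitz1984, Sect. 2.7.2 (2.7.2.3)] -/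
noncomputable def gaussNodePoly {n : ℕ} (x : Fin n → K) : K[X] := ∏ i, (X - C (x i))

/-- The node polynomial vanishes at every node. [cite: DavisRabinowitz1984, Sect. 2.7.2 (2.7.2.3)] -/
theorem gaussNodePoly_eval_node {n : ℕ} (x : Fin n → K) (i : Fin n) :
    (gaussNodePoly x).eval (x i) = 0 := by
  rw [gaussNodePoly, eval_prod]
  exact prod_eq_zero (mem_univ i) (by simp)

/-- The node polynomial is monic of degree `n` (`c_n = 1` in (2.7.2.3)).
[cite: DavisRabinowitz1984, Sect. 2.7.2 (2.7.2.3)] -/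
theorem gaussNodePoly_monic {n : ℕ} (x : Fin n → K) : (gaussNodePoly x).Monic :=
  monic_prod_of_monic _ _ fun i _ => monic_X_sub_C (x i)

/-- The node polynomial has degree exactly `n`. [cite: DavisRabinowitz1984, Sect. 2.7.2 (2.7.2.3)] -/
theorem gaussNodePoly_natDegree {n : ℕ} (x : Fin n → K) : (gaussNodePoly x).natDegree = n := by
  rw [gaussNodePoly, natDegree_prod_of_monic _ _ fun i _ => monic_X_sub_C (x i)]
  simp

/-- **(2.7.2.5)**: if the rule `(w, x)` reproduces the moments `m_0, …, m_{2n-1}` (2.7.2.2), then the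
coefficients `c_k` of the node polynomial solve the Hankel system `Σ_{k=0}^{n} m_{j+k} c_k = 0`,
`j = 0, …, n-1`. [cite: DavisRabinowitz1984, Sect. 2.7.2 (2.7.2.5)] -/
theorem hankel_sum_coeff_gaussNodePoly_eq_zero {n : ℕ} (w x : Fin n → K) (m : ℕ → K)
    (hm : ∀ j, j ≤ 2 * n - 1 → ∑ i, w i * x i ^ j = m j) {j : ℕ} (hj : j + 1 ≤ n) :
    ∑ k ∈ range (n + 1), m (j + k) * (gaussNodePoly x).coeff k = 0 := by
  have hdeg := gaussNodePoly_natDegree x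
  calc ∑ k ∈ range (n + 1), m (j + k) * (gaussNodePoly x).coeff k
      = ∑ k ∈ range (n + 1), (∑ i, w i * x i ^ (j + k)) * (gaussNodePoly x).coeff k := by
        refine sum_congr rfl fun k hk => ?_
        rw [hm (j + k) (by have := mem_range.mp hk; omega)]
    _ = ∑ i, w i * x i ^ j * ∑ k ∈ range (n + 1), (gaussNodePoly x).coeff k * x i ^ k := by
        simp_rw [sum_mul, mul_sum]
        rw [sum_comm]
        refine sum_congr rfl fun i _ => sum_congr rfl fun k _ => ?_
        ring
    _ = ∑ i, w i * x i ^ j * (gaussNodePoly x).eval (x i) := by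
        refine sum_congr rfl fun i _ => ?_
        rw [eval_eq_sum_range' (n := n + 1) (by rw [hdeg]; exact Nat.lt_succ_self n)]
    _ = 0 := by simp [gaussNodePoly_eval_node]

/-- **Converse step of the algebraic approach**: if the node polynomial's coefficients solve the Hankel
system (2.7.2.5) (`Σ_{k=0}^{n} m_{j+k} c_k = 0`, `j < n`) and the weights reproduce the first `n` moments
`m_0, …, m_{n-1}`, then the rule reproduces all `2n` moments `m_0, …, m_{2n-1}` (2.7.2.2) — the text's
procedure read backwards: solve (2.7.2.5) for `p`, take its roots as nodes, then the weights from the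
first `n` equations. [cite: DavisRabinowitz1984, Sect. 2.7.2 (2.7.2.5)] -/
theorem moments_of_hankel_of_low_moments {n : ℕ} (w x : Fin n → K) (m : ℕ → K)
    (hH : ∀ j, j + 1 ≤ n → ∑ k ∈ range (n + 1), m (j + k) * (gaussNodePoly x).coeff k = 0)
    (hlow : ∀ j, j + 1 ≤ n → ∑ i, w i * x i ^ j = m j) :
    ∀ j, j + 1 ≤ 2 * n → ∑ i, w i * x i ^ j = m j := by
  intro j
  induction j using Nat.strong_induction_on with
  | _ j ih =>
    intro hj
    by_cases hjn : j + 1 ≤ n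
    · exact hlow j hjn
    · -- `j ≥ n`: reduce `x_i^j` with `p(x_i) = 0`, i.e. `x_i^n = -Σ_{k<n} c_k x_i^k`
      obtain ⟨t, rfl⟩ : ∃ t, j = t + n := ⟨j - n, by omega⟩
      have ht : t + 1 ≤ n := by omega
      have hdeg := gaussNodePoly_natDegree x
      have hlead : (gaussNodePoly x).coeff n = 1 := by
        have := (gaussNodePoly_monic x).leadingCoeff; rwa [Polynomial.leadingCoeff, hdeg] at this
      have hroot : ∀ i, x i ^ n = -∑ k ∈ range n, (gaussNodePoly x).coeff k * x i ^ k := by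
        intro i
        have h0 := gaussNodePoly_eval_node x i
        rw [eval_eq_sum_range' (n := n + 1) (by rw [hdeg]; exact Nat.lt_succ_self n),
          sum_range_succ, hlead, one_mul] at h0
        linear_combination h0
      -- the Hankel row `t`: `m_{t+n} = -Σ_{k<n} c_k m_{t+k}` (using `c_n = 1`)
      have hrow : m (t + n) = -∑ k ∈ range n, (gaussNodePoly x).coeff k * m (t + k) := by
        have h0 := hH t ht
        rw [sum_range_succ, hlead, mul_one] at h0
        have hc : ∑ k ∈ range n, m (t + k) * (gaussNodePoly x).coeff k
            = ∑ k ∈ range n, (gaussNodePoly x).coeff k * m (t + k) :=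
          sum_congr rfl fun k _ => mul_comm _ _
        rw [hc] at h0
        linear_combination h0
      have hterm : ∀ i, w i * x i ^ t * (-∑ k ∈ range n, (gaussNodePoly x).coeff k * x i ^ k)
          = -∑ k ∈ range n, (gaussNodePoly x).coeff k * (w i * x i ^ (t + k)) := by
        intro i; rw [mul_neg, mul_sum]; congr 1; exact sum_congr rfl fun k _ => by ring
      calc ∑ i, w i * x i ^ (t + n)
          = ∑ i, w i * x i ^ t * (-∑ k ∈ range n, (gaussNodePoly x).coeff k * x i ^ k) := by
            refine sum_congr rfl fun i _ => ?_; rw [pow_add, hroot i, mul_assoc]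
        _ = -∑ k ∈ range n, (gaussNodePoly x).coeff k * ∑ i, w i * x i ^ (t + k) := by
            rw [sum_congr rfl fun i _ => hterm i, sum_neg_distrib, sum_comm]; simp_rw [mul_sum]
        _ = -∑ k ∈ range n, (gaussNodePoly x).coeff k * m (t + k) := by
            congr 1; refine sum_congr rfl fun k hk => ?_
            have hk' := mem_range.mp hk
            rw [ih (t + k) (by omega) (by omega)]
        _ = m (t + n) := hrow.symm

end Literature.Analysis.Quadrature
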